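import Literature.Computability.QuantumComplexity.LightConeAmp
import HarnessLib

/-!
# The state-vector simulator of a light cone: sparse states, gate application, correctness

Functional model (on mathematical objects) of the polynomial-time machine that decides a
language given by a logarithmic-depth local Clifford+`T` family (discharge of
`Literature.Barriers.QuantumAdvantage.markovShi2008_cor15_anyOrder`, Markov–Shi 2008, Cor. 1.5, decision
form; the machine itself is written in the `FP` brick algebra in the `LightConeMachine*.lean`
files and computes literally the functions of this file on codes). A state vector supported on
the labels of a cone `S` (the labels agreeing with a base label off `S`) is stored **sparsely** as
an association list `List (QReg N × Amp)` from labels to `ℤ[ω]`-coordinates (`LightConeAmp.lean`),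
the global factor `2^{-h/2}` (`h` = Hadamard count) being implicit:

* `lookup st y` (first entry with key `y`, default `0`), `applyGate g st` (one gate, pull form:
  the new coordinate of every stored label is computed from lookups in the old list; the list
  comes out reversed), `runGates`;
* `InCone S base`, and the invariant `Represents ζ S base h st v`: keys without duplicates, keys =
  the cone labels, `v y = (1/√2)^h · eval ζ (lookup st y)` on stored labels, `v = 0` off the cone;
* **`Represents.applyGate`**: the invariant is preserved by a gate acting inside `S`, the vector
  becoming `semZeta ζ g *ᵥ v` and `h` growing by one for an `H` gate (`ζ² = i`; both `ζ = ω`, the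
  circuit, and `ζ = ω⁵`, its Galois conjugate, are covered); `Represents.runGates`.

The initial state and the read-out of the acceptance probability are in `LightConeSimInit.lean`.

## References

* M. A. Nielsen, I. L. Chuang, *Quantum Computation and Quantum Information*, CUP 2010, §4.5.5 and
  Box 4.1 (classical simulation by tracking all amplitudes), §4.2 (the gates).
* I. L. Markov, Y. Shi, SIAM J. Comput. 38 (2008), §1, Cor. 1.5 (the statement served).
-/

noncomputable section

namespace Literature.Computability.QuantumComplexity

open _root_.Computability Complexity Cryptography Matrix

namespace LightCone

variable {N : ℕ}

/-! ### Sparse states -/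

/-- **Lookup** of the coordinates stored for the label `y`: the first entry with key `y`, or `0`
if there is none. [folklore] -/
def lookup : List (QReg N × Amp) → QReg N → Amp
  | [], _ => 0
  | p :: st, y => if p.1 = y then p.2 else lookup st y

/-- Lookup in the empty state. [folklore] -/
@[simp] theorem lookup_nil (y : QReg N) : lookup ([] : List (QReg N × Amp)) y = 0 := rfl

/-- Lookup past one entry. [folklore] -/
theorem lookup_cons (p : QReg N × Amp) (st : List (QReg N × Amp)) (y : QReg N) :
    lookup (p :: st) y = if p.1 = y then p.2 else lookup st y := rfl

/-- A label that is not a key looks up to `0`. [folklore] -/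
theorem lookup_eq_zero_of_not_mem {st : List (QReg N × Amp)} {y : QReg N}
    (h : y ∉ st.map Prod.fst) : lookup st y = 0 := by
  induction st with
  | nil => rfl
  | cons p st ih =>
    simp only [List.map_cons, List.mem_cons, not_or] at h
    rw [lookup_cons, if_neg (Ne.symm h.1), ih h.2]

/-- With duplicate-free keys, a stored entry is what its key looks up to. [folklore] -/
theorem lookup_eq_of_mem {st : List (QReg N × Amp)} (hnd : (st.map Prod.fst).Nodup)
    {p : QReg N × Amp} (hp : p ∈ st) : lookup st p.1 = p.2 := by
  induction st with
  | nil => simp at hp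
  | cons q st ih =>
    simp only [List.map_cons, List.nodup_cons, List.mem_map, not_exists, not_and] at hnd
    rcases List.mem_cons.1 hp with rfl | hp'
    · rw [lookup_cons, if_pos rfl]
    · rw [lookup_cons, if_neg (fun h => hnd.1 p hp' h.symm), ih hnd.2 hp']

/-! ### One gate in the pull form -/

/-- **The new coordinates of a stored label after one gate** (pull form of
`semZeta_mulVec_apply_H/S/T/CNOT`): `H_i`: `L(y[i↦0]) ± L(y[i↦1])` (the factor `1/√2` goes into
`h`); `S_i`, `T_i`: the entry's own coordinates times `ζ^{2 y_i}`, `ζ^{y_i}`; `CNOT_{ij}`: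
`L(y[j ↦ y_j ⊕ y_i])`; oracle gates (never present) keep the entry. `L` = lookup in the old
state. (Nielsen–Chuang 2010, §4.2, Box 4.1.) [folklore] -/
def newAmp (st : List (QReg N × Amp)) : QGate cliffordT N → QReg N × Amp → Amp
  | .gate .H e, p =>
      lookup st (Function.update p.1 (embH e 0) false) +
        (if p.1 (embH e 0) = true then -lookup st (Function.update p.1 (embH e 0) true)
         else lookup st (Function.update p.1 (embH e 0) true))
  | .gate .S e, p => if p.1 (embS e 0) = true then p.2.mulOmega.mulOmega else p.2
  | .gate .T e, p => if p.1 (embT e 0) = true then p.2.mulOmega else p.2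
  | .gate .CNOT e, p => lookup st (Function.update p.1 (embC e 1) (p.1 (embC e 1) ^^ p.1 (embC e 0)))
  | .oracle _ _, p => p.2

/-- **Applying one gate** to a sparse state: every stored label gets its new coordinates; the
list is rebuilt by pushing, hence reversed. [folklore] -/
def applyGate (g : QGate cliffordT N) (st : List (QReg N × Amp)) : List (QReg N × Amp) :=
  st.foldl (fun out p => (p.1, newAmp st g p) :: out) []

/-- **Applying a gate list** (head first). [folklore] -/
def runGates (gs : List (QGate cliffordT N)) (st : List (QReg N × Amp)) : List (QReg N × Amp) :=
  gs.foldl (fun st g => applyGate g st) st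

/-- Pushing the images of the items of a list onto an accumulator. [folklore] -/
theorem foldl_cons_eq_reverse_map {α β : Type*} (f : α → β) :
    ∀ (l : List α) (acc : List β), l.foldl (fun out a => f a :: out) acc = (l.map f).reverse ++ acc
  | [], acc => by simp
  | a :: l, acc => by
    rw [List.foldl_cons, foldl_cons_eq_reverse_map f l, List.map_cons, List.reverse_cons,
      List.append_assoc, List.singleton_append]

/-- `applyGate` is the reversed map of the update. [folklore] -/
theorem applyGate_eq (g : QGate cliffordT N) (st : List (QReg N × Amp)) :
    applyGate g st = (st.map fun p => (p.1, newAmp st g p)).reverse := by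
  rw [applyGate, foldl_cons_eq_reverse_map, List.append_nil]

/-- The keys after a gate are the old keys, reversed. [folklore] -/
theorem map_fst_applyGate (g : QGate cliffordT N) (st : List (QReg N × Amp)) :
    (applyGate g st).map Prod.fst = (st.map Prod.fst).reverse := by
  rw [applyGate_eq, List.map_reverse, List.map_map]
  rfl

/-- The entries after a gate. [folklore] -/
theorem mem_applyGate_iff (g : QGate cliffordT N) (st : List (QReg N × Amp)) (q : QReg N × Amp) :
    q ∈ applyGate g st ↔ ∃ p ∈ st, (p.1, newAmp st g p) = q := by
  rw [applyGate_eq, List.mem_reverse, List.mem_map]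

/-- `runGates` on a cons. [folklore] -/
theorem runGates_cons (g : QGate cliffordT N) (gs : List (QGate cliffordT N)) (st : List (QReg N × Amp)) :
    runGates (g :: gs) st = runGates gs (applyGate g st) := rfl

/-- The number of stored entries is preserved by a gate. [folklore] -/
theorem length_applyGate (g : QGate cliffordT N) (st : List (QReg N × Amp)) :
    (applyGate g st).length = st.length := by
  rw [applyGate_eq, List.length_reverse, List.length_map]

/-- The number of stored entries is preserved by a gate list. [folklore] -/
theorem length_runGates : ∀ (gs : List (QGate cliffordT N)) (st : List (QReg N × Amp)),
    (runGates gs st).length = st.length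
  | [], st => rfl
  | g :: gs, st => by rw [runGates_cons, length_runGates gs, length_applyGate]

/-! ### The representation invariant -/

/-- The labels of the cone of `S` around `base`: those agreeing with `base` off `S`. [folklore] -/
def InCone (S : Finset (Fin N)) (base : QReg N) (y : QReg N) : Prop := ∀ i, i ∉ S → y i = base i

/-- Changing a label inside `S` does not move it into or out of the cone. [folklore] -/
theorem inCone_update_iff {S : Finset (Fin N)} {base : QReg N} {i : Fin N} (hi : i ∈ S)
    (y : QReg N) (b : Bool) : InCone S base (Function.update y i b) ↔ InCone S base y := by
  refine forall_congr' fun l => ?_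
  by_cases hl : l = i
  · subst hl; exact ⟨fun _ _ => absurd hi ‹_›, fun _ _ => absurd hi ‹_›⟩
  · rw [Function.update_of_ne hl]

/-- **The representation invariant.** The sparse state `st` represents the vector `v` with `h`
Hadamard factors, for the `ζ`-semantics: duplicate-free keys, the keys are exactly the labels of
the cone, each stored label carries `v y · √2^h` in `ℤ[ζ]`-coordinates, and `v` vanishes off the
cone. [folklore] -/
structure Represents (ζ : ℂ) (S : Finset (Fin N)) (base : QReg N) (h : ℕ)
    (st : List (QReg N × Amp)) (v : QReg N → ℂ) : Prop where
  /-- no label is stored twice -/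
  nodup : (st.map Prod.fst).Nodup
  /-- the stored labels are the labels of the cone -/
  mem_iff : ∀ y, y ∈ st.map Prod.fst ↔ InCone S base y
  /-- stored coordinates are the amplitudes up to `2^{-h/2}` -/
  val : ∀ p ∈ st, v p.1 = invSqrt2 ^ h * Amp.eval ζ p.2
  /-- the vector is supported on the cone -/
  zero : ∀ y, ¬ InCone S base y → v y = 0

namespace Represents

variable {ζ : ℂ} {S : Finset (Fin N)} {base : QReg N} {h : ℕ} {st : List (QReg N × Amp)}
  {v : QReg N → ℂ}

/-- **Every amplitude is the looked-up coordinate** (stored labels by `val`, the others are off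
the cone and both sides vanish). [folklore] -/
theorem apply_eq_lookup (hr : Represents ζ S base h st v) (y : QReg N) :
    v y = invSqrt2 ^ h * Amp.eval ζ (lookup st y) := by
  by_cases hy : y ∈ st.map Prod.fst
  · obtain ⟨p, hp, rfl⟩ := List.mem_map.1 hy
    rw [lookup_eq_of_mem hr.nodup hp, hr.val p hp]
  · rw [lookup_eq_zero_of_not_mem hy, hr.zero y (fun hc => hy ((hr.mem_iff y).2 hc)), Amp.eval_zero,
      mul_zero]

/-- A stored label lies in the cone. [folklore] -/
theorem inCone_of_mem (hr : Represents ζ S base h st v) {p : QReg N × Amp} (hp : p ∈ st) :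
    InCone S base p.1 :=
  (hr.mem_iff p.1).1 (List.mem_map.2 ⟨p, hp, rfl⟩)

/-- **One gate preserves the invariant.** For `ζ² = i`, an oracle-free gate `g` acting inside
`S`: `applyGate g st` represents `semZeta ζ g *ᵥ v` with `h + [g = H]` Hadamard factors.
(Nielsen–Chuang 2010, §4.2, Box 4.1.) [folklore] -/
theorem applyGate (hζ : ζ ^ 2 = Complex.I) (hr : Represents ζ S base h st v)
    {g : QGate cliffordT N} (hg : g.IsOracleFree) (hgS : g.wires ⊆ S) :
    Represents ζ S base (h + if QGateIsH g then 1 else 0) (LightCone.applyGate g st)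
      (semZeta ζ g *ᵥ v) := by
  have h4 := zeta_pow_four hζ
  refine ⟨?_, fun y => ?_, fun q hq => ?_, fun y hy => ?_⟩
  · rw [map_fst_applyGate, List.nodup_reverse]; exact hr.nodup
  · rw [map_fst_applyGate, List.mem_reverse]; exact hr.mem_iff y
  · obtain ⟨p, hp, rfl⟩ := (mem_applyGate_iff g st q).1 hq
    have hL := hr.apply_eq_lookup
    cases g with
    | oracle k e => exact absurd hg id
    | gate op e =>
      cases op with
      | H =>
        simp only [newAmp, QGateIsH, if_true, pow_succ]
        rw [semZeta_mulVec_apply_H, hL, hL]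
        cases p.1 (embH e 0) <;> simp <;> ring
      | S =>
        simp only [newAmp, QGateIsH, Bool.false_eq_true, if_false, add_zero]
        rw [semZeta_mulVec_apply_S, hr.val p hp]
        cases p.1 (embS e 0)
        · simp
        · simp only [if_true, Amp.eval_mulOmega h4]
          rw [← hζ]; ring
      | T =>
        simp only [newAmp, QGateIsH, Bool.false_eq_true, if_false, add_zero]
        rw [semZeta_mulVec_apply_T, hr.val p hp]
        cases p.1 (embT e 0)
        · simp
        · simp only [if_true, Amp.eval_mulOmega h4]; ring
      | CNOT =>
        simp only [newAmp, QGateIsH, Bool.false_eq_true, if_false, add_zero]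
        rw [semZeta_mulVec_apply_CNOT, hL]
  · cases g with
    | oracle k e => exact absurd hg id
    | gate op e =>
      cases op with
      | H =>
        have hi : embH e 0 ∈ S := hgS (Finset.mem_map_of_mem e (Finset.mem_univ (0 : Fin 1)))
        rw [semZeta_mulVec_apply_H, hr.zero _ (fun hc => hy ((inCone_update_iff hi y _).1 hc)),
          hr.zero _ (fun hc => hy ((inCone_update_iff hi y _).1 hc))]
        simp
      | S => rw [semZeta_mulVec_apply_S, hr.zero y hy, mul_zero]
      | T => rw [semZeta_mulVec_apply_T, hr.zero y hy, mul_zero]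
      | CNOT =>
        have hj : embC e 1 ∈ S := hgS (Finset.mem_map_of_mem e (Finset.mem_univ (1 : Fin 2)))
        rw [semZeta_mulVec_apply_CNOT, hr.zero _ (fun hc => hy ((inCone_update_iff hj y _).1 hc))]

/-- **A gate list preserves the invariant**, the vector becoming `prodZeta ζ gs *ᵥ v` and `h`
growing by the Hadamard count. [folklore] -/
theorem runGates (hζ : ζ ^ 2 = Complex.I) :
    ∀ {gs : List (QGate cliffordT N)} {h : ℕ} {st : List (QReg N × Amp)} {v : QReg N → ℂ},
      Represents ζ S base h st v → (∀ g ∈ gs, g.IsOracleFree) → (∀ g ∈ gs, g.wires ⊆ S) →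
      Represents ζ S base (h + hCount gs) (LightCone.runGates gs st) (prodZeta ζ gs *ᵥ v)
  | [], h, st, v, hr, _, _ => by simpa [LightCone.runGates, hCount] using hr
  | g :: gs, h, st, v, hr, hfree, hS => by
    have h1 := hr.applyGate hζ (hfree g List.mem_cons_self) (hS g List.mem_cons_self)
    have h2 := runGates hζ h1 (fun g' hg' => hfree g' (List.mem_cons_of_mem g hg'))
      (fun g' hg' => hS g' (List.mem_cons_of_mem g hg'))
    rw [runGates_cons, prodZeta_cons, ← Matrix.mulVec_mulVec, hCount_cons]
    have heq : h + (hCount gs + (if QGateIsH g then 1 else 0)) =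
        h + (if QGateIsH g then 1 else 0) + hCount gs := by
      split <;> omega
    rw [heq]
    exact h2

end Represents

end LightCone

end Literature.Computability.QuantumComplexity

end
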